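import Literature.NumberTheory.Rogawski1990.ArchHcJumpTwoChartOrbital             -- ★ (F0P3a-p08 (g23)): 2b tokens `hcNrm ∕ hcThird ∕ hcCayPt`; brings ★ p851042 `contDiff_splitIntegral_param`, ★ `archERho`, `InRegS`
import Literature.NumberTheory.Automorphic.ArchWallOrthantFunctionalSmooth         -- ★ p851151 (this seat): `exists_isCompact_forall_conj_cayleyTorus_mem_imp_mem` (properness of the Cayley torus orbit map)
import Literature.NumberTheory.Automorphic.ArchCartanStableSum                     -- ★ `flipSet`, `flipSet_apply_of_mem ∕ _of_not_mem`, `flipSet_mem_inRegS_iff`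
import Literature.NumberTheory.Rogawski1990.ArchBouazizJumpPropagation              -- ★ `contDiff_archERho`
import Literature.NumberTheory.Automorphic.ArchEndoscopicCartanAtlas               -- ★ `hypBlockGL`, `coe_hypBlockGL`, `hypBlockGL_mem_archLocal`
import Literature.NumberTheory.Automorphic.ArchEndoscopicChartLocal                -- ★ `secondCountableTopology_archLocal_two`, `locallyCompactSpace_archLocal_two`
import Literature.NumberTheory.Automorphic.ArchRankOneJumpZeroCone                 -- ★ `isClosedEmbedding_coe_unitaryGroupOfForm_of_eq_over`, `cayley_conj_circleDiagonal_mem_of_eq_over`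
import Mathlib.Topology.ContinuousMap.Bounded.Normed
import HarnessLib

/-!
# THE TWO-CHART DESCENT PACKAGE FOR THE STABLE FAMILY OF `H_∞` AT A NONCOMPACT WALL: `hdesc₁ ∧ hdesc₂` of ★ 2b in reader currency, from the wall-set representation
# (Shelstad 1979 §4 pp. 22–25, Lemma 4.3; Bouaziz 1994 §3.1–3.2, §6.2; Rogawski 1990 §4.1 (4.1.1), §8.2; Varadarajan 1989 §6.4)

Topic `NumberTheory/Rogawski1990`; namespace `Literature.NumberTheory.Rogawski1990`.  THEOREMS ONLY (no `def`, no instance, no notation beyond the local `Φ₂[L]` abbreviation, no axiom,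
no named fact, no `sorry`); kernel lane `--kind proof --supports stmt-HodgeConjecture-24833`.  Cell `pub/hodgecm-mathlib`, crux H413 (`stmt-HodgeConjecture-24833`), F0∕P3c line LH3
(closer stub `stub_N9`, leaf `F0_P3c_StubN9Direct`), letter L3′ forward half = the jump clause (J) of `ArchBouazizSpaceH jcH (stOrbFamH L νH fH)` for a GENERAL `fH`; brick **(JH-desc)**
of `F0/P3c/LH3/LH3-p01/g5/JH-SPEC.v2.md` (LH3-p01 (g5), JH binder of record); inputs (JH-A) (LH10-p02 (g7)), (JH-B) (LH10-p01 (g5)), (JH-A′); consumer (JH-asm) (LH3-p03 (g6)) through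
★ (JH-st-2) `hasOneSidedJump_iteratedFDeriv_adaptedWord_of_twoChart_orbital_stable`.  Count-neutral.

THE MATHEMATICS.  `W` = complex places, `w₀ ∉ S`, `S′ = insert w₀ S`, `ν c = (c w₀ 0 − c w₀ 2)∕2`, `π c = c − ν c • hcNrm w₀ 0 2`, `ĉ″ = update c″ w₀ (c″ w₀ 2, c″ w₀ 1, c″ w₀ 2)`.
On `InRegS`, both families are modelled (★ `exists_placeLeaves_stOrbFamH_model` (c) ∕ (JH-A)) as `Ψ c = K₀ · E_S(c) · Σ_{T ⊆ Sᶜ} I(flipSet T c)` with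
`E_S = Π_w [w ∈ S ? e^{x_w} : 1 − e^{i(c_w2 − c_w0)}]`, and `archERho S · E_S = 2i sin(ν c) · PF(π c)`, `archERho S′ · E_{S′} = e^{x} · PF(ĉ″)`, `PF` the (smooth, ν-free) product of the
factors at `w ≠ w₀`.  The wall-set representation (JH-B) reads `I` on the compact chart as `ℓ ∫_{U(Φ₂)_{w₀}} g(c, ↑↑(h P t_1(ν c) P⁻¹ h⁻¹)) dν₀` and on the split chart as
`ℓ ∫ g(ĉ′, e^{−iθ} • ↑↑(z₁ γ′ z₂ z₁⁻¹)) dΛ′`, ONE `g` constant along the normal; the flips `T ∌ w₀` commute with `π` and `ĉ`, the flips `T ∋ w₀` read `t_1(−ν c)` — whence the ODD-ISED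
reader; `ℓ` goes inside (Bochner), so `G q X := Σ_{T ⊆ Sᶜ ∖ {w₀}} ℓ g(flipSet T q, X)` is a ℂ-valued admissible family; on the split side (JH-A′) converts the leaf integral into
`(C∕C′)·e^{−x} •` the `K × N` half-chart integral, the centre `e^{−iθ}` cancelling `t_{0,θ}`, and `e^{x}·e^{−x} = 1`; the real wall `x = 0` is reached by continuity of both sides.
RESULT (`exists_twoChart_descent_of_representation`): `∃ U₁ U₂ G`, open, admissible, `PF` smooth, with ★ 2b's `hdesc₁` (ODD-ISED reader, `K₁ = I·K₀`, `ce = ch = 1`, `Ef = 0`) and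
`hdesc₂` (`K₂ = K₀′·(C∕C′)`) for `F₁ = archERho S · Ψ`, `F₂ = archERho S′ · Ψ′` — in the tokens of ★ (JH-st-2) at `(w, i, j) := (w₀, 0, 2)`, readers at `J := σ_{w₀}Φ₂` spelled `archLocal L 2 Φ₂ w₀`.
HONEST LABEL: HC_CM is proved only modulo the 7 printed citations (2 remaining: hLiu418 = `stmt-HodgeConjecture-24832`, h413 = `stmt-HodgeConjecture-24833`) until rung 0 closes; this file
is plumbing between ★ bricks and pays nothing by itself.

## References
* [Shelstad1979] D. Shelstad, *Characters and inner forms of a quasi-split group over ℝ*, Compositio Math. 39 (1979), §4 pp. 22–25, Lemma 4.3 p. 25, Thm. 4.7 (IIIb) p. 31.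
* [Bouaziz1994IntegralesOrbitales] A. Bouaziz, *Intégrales orbitales sur les groupes de Lie réductifs*, Ann. Sci. ÉNS 27 (1994), §3.1 p. 579, §3.2 (I₃) p. 580, §6.2 p. 591.
* [Rogawski1990] J. D. Rogawski, *Automorphic Representations of Unitary Groups in Three Variables*, Ann. of Math. Stud. 123 (1990), §4.1 (4.1.1) p. 39, §8.2 pp. 119–123.
* [Varadarajan1989] V. S. Varadarajan, *An Introduction to Harmonic Analysis on Semisimple Lie Groups*, Cambridge Stud. Adv. Math. 16 (1989), §6.4 Lemma 21, Thms 23–24.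
-/

set_option autoImplicit false

noncomputable section

open Set Filter Function Complex MeasureTheory Measure NumberField NumberField.InfinitePlace Topology
open scoped Topology ContDiff MatrixGroups Matrix.Norms.Operator NNReal ENNReal Classical BoundedContinuousFunction
open Literature.NumberTheory.Automorphic Literature.NumberTheory.Automorphic.UnitaryGroup Literature.NumberTheory.Automorphic.ArchCartan
open Literature.NumberTheory.Automorphic.Shelstad1979.StableOrbitalIntegrals Literature.Analysis.Calculus

namespace Literature.NumberTheory.Rogawski1990

local notation3 "Φ₂[" L "]" => (Matrix.of fun i j : Fin 2 => if i.val + j.val + 1 = 2 then (1 : L) else 0)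

/-! ## §1 Integrability of the two orbit integrands (the test function has compact matrix support) -/

section Integrability

variable (L : Type) [Field L] [NumberField L] (w₀ : {w : InfinitePlace L // IsComplex w})
  (hJ : Matrix.map Φ₂[L] w₀.1.embedding = (StdForm.antidiagonal 2).over ℂ)
  {E : Type*} [NormedAddCommGroup E]

include hJ in
/-- **The compact-chart orbit integrand is integrable** (see the module docstring): for `f` continuous on `M₂(ℂ)` vanishing off a compact set and `sin ψ ≠ 0`,
`h ↦ f ↑↑(h · P t_1(ψ) P⁻¹ · h⁻¹)` is continuous with compact support on `U(J) = U(Φ₂)_{w₀}` (★ `exists_isCompact_forall_conj_cayleyTorus_mem_imp_mem`; the coefficient map is a closed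
embedding). [cite: Varadarajan1989, §6.4 Lemma 21] [cite: Rogawski1990, §8.2 p. 122] -/
theorem integrable_comp_conj_cayleyTorus_of_support
    [MeasurableSpace ↥(unitaryGroupOfForm (starRingEnd ℂ) (Matrix.map Φ₂[L] w₀.1.embedding))] [BorelSpace ↥(unitaryGroupOfForm (starRingEnd ℂ) (Matrix.map Φ₂[L] w₀.1.embedding))]
    (ν₀ : Measure ↥(unitaryGroupOfForm (starRingEnd ℂ) (Matrix.map Φ₂[L] w₀.1.embedding))) [IsFiniteMeasureOnCompacts ν₀]
    {f : Matrix (Fin 2) (Fin 2) ℂ → E} (hf : Continuous f) {Kmat : Set (Matrix (Fin 2) (Fin 2) ℂ)} (hKmat : IsCompact Kmat) (hf0 : ∀ X, X ∉ Kmat → f X = 0)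
    {ψ : ℝ} (hψ : Real.sin ψ ≠ 0) :
    Integrable (fun h : ↥(unitaryGroupOfForm (starRingEnd ℂ) (Matrix.map Φ₂[L] w₀.1.embedding)) => f (((h * ⟨Matrix.GeneralLinearGroup.mkOfDetNeZero !![(1 : ℂ), 1; 1, -1] det_cayleyTwo_ne_zero *
        circleDiagonal 2 ![1 * Circle.exp ψ, 1 * Circle.exp (-ψ)] * (Matrix.GeneralLinearGroup.mkOfDetNeZero !![(1 : ℂ), 1; 1, -1] det_cayleyTwo_ne_zero)⁻¹,
        cayley_conj_circleDiagonal_mem_of_eq_over hJ _⟩ * h⁻¹ : ↥(unitaryGroupOfForm (starRingEnd ℂ) (Matrix.map Φ₂[L] w₀.1.embedding))) : GL (Fin 2) ℂ) : Matrix (Fin 2) (Fin 2) ℂ)) ν₀ := by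
  have hemb : IsClosedEmbedding (fun g : ↥(unitaryGroupOfForm (starRingEnd ℂ) (Matrix.map Φ₂[L] w₀.1.embedding)) => ((g : GL (Fin 2) ℂ) : Matrix (Fin 2) (Fin 2) ℂ)) :=
    isClosedEmbedding_coe_unitaryGroupOfForm_of_eq_over hJ
  have hC : IsCompact {y : ↥(unitaryGroupOfForm (starRingEnd ℂ) (Matrix.map Φ₂[L] w₀.1.embedding)) | ((y : GL (Fin 2) ℂ) : Matrix (Fin 2) (Fin 2) ℂ) ∈ Kmat} := hemb.isCompact_preimage hKmat
  obtain ⟨𝒞, h𝒞c, h𝒞⟩ := exists_isCompact_forall_conj_cayleyTorus_mem_imp_mem L w₀ 1 (isCompact_singleton (x := ψ)) (fun ψ₁ hψ₁ => by rw [Set.mem_singleton_iff.1 hψ₁]; exact hψ) hC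
  have hcont : Continuous (fun h : ↥(unitaryGroupOfForm (starRingEnd ℂ) (Matrix.map Φ₂[L] w₀.1.embedding)) => f (((h * ⟨Matrix.GeneralLinearGroup.mkOfDetNeZero !![(1 : ℂ), 1; 1, -1] det_cayleyTwo_ne_zero *
        circleDiagonal 2 ![1 * Circle.exp ψ, 1 * Circle.exp (-ψ)] * (Matrix.GeneralLinearGroup.mkOfDetNeZero !![(1 : ℂ), 1; 1, -1] det_cayleyTwo_ne_zero)⁻¹,
        cayley_conj_circleDiagonal_mem_of_eq_over hJ _⟩ * h⁻¹ : ↥(unitaryGroupOfForm (starRingEnd ℂ) (Matrix.map Φ₂[L] w₀.1.embedding))) : GL (Fin 2) ℂ) : Matrix (Fin 2) (Fin 2) ℂ)) :=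
    hf.comp (hemb.continuous.comp ((continuous_id.mul continuous_const).mul continuous_id.inv))
  refine hcont.integrable_of_hasCompactSupport (HasCompactSupport.intro h𝒞c fun y hy => ?_)
  by_contra hne
  exact hy (h𝒞 y ψ (Set.mem_singleton ψ) (by_contra fun hmem => hne (hf0 _ hmem)))

omit [NumberField L] in
/-- **The split-chart leaf integrand is integrable**: for a leaf `Λ′` on `U × U` carried by `Z′` (null complement) with the properness clause of ★ (α1) at the torus element `γ`, and
`φ` continuous on `U(Φ₂)_{w₀}` vanishing off a compact set, `z ↦ φ(z₁ γ z₂ z₁⁻¹)` is `Λ′`-integrable (continuous, and a.e. supported in the compact `𝒮`).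
[cite: Varadarajan1989, §6.4 Lemma 21] [cite: Rogawski1990, §8.2 p. 119] -/
theorem integrable_comp_conj_leaf_of_support
    [MeasurableSpace ↥(unitaryGroupOfForm (starRingEnd ℂ) (Matrix.map Φ₂[L] w₀.1.embedding))] [BorelSpace ↥(unitaryGroupOfForm (starRingEnd ℂ) (Matrix.map Φ₂[L] w₀.1.embedding))]
    (Λ' : Measure (↥(unitaryGroupOfForm (starRingEnd ℂ) (Matrix.map Φ₂[L] w₀.1.embedding)) × ↥(unitaryGroupOfForm (starRingEnd ℂ) (Matrix.map Φ₂[L] w₀.1.embedding)))) [IsFiniteMeasureOnCompacts Λ']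
    (Z' : Set (↥(unitaryGroupOfForm (starRingEnd ℂ) (Matrix.map Φ₂[L] w₀.1.embedding)) × ↥(unitaryGroupOfForm (starRingEnd ℂ) (Matrix.map Φ₂[L] w₀.1.embedding)))) (hZ'null : Λ' Z'ᶜ = 0) (γ : ↥(unitaryGroupOfForm (starRingEnd ℂ) (Matrix.map Φ₂[L] w₀.1.embedding)))
    (hprop : ∀ C' : Set ↥(unitaryGroupOfForm (starRingEnd ℂ) (Matrix.map Φ₂[L] w₀.1.embedding)), IsCompact C' →
      ∃ 𝒮 : Set (↥(unitaryGroupOfForm (starRingEnd ℂ) (Matrix.map Φ₂[L] w₀.1.embedding)) × ↥(unitaryGroupOfForm (starRingEnd ℂ) (Matrix.map Φ₂[L] w₀.1.embedding))), IsCompact 𝒮 ∧ ∀ z ∈ Z', z.1 * (γ * z.2) * z.1⁻¹ ∈ C' → z ∈ 𝒮)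
    {φ : ↥(unitaryGroupOfForm (starRingEnd ℂ) (Matrix.map Φ₂[L] w₀.1.embedding)) → E} (hφ : Continuous φ) {C' : Set ↥(unitaryGroupOfForm (starRingEnd ℂ) (Matrix.map Φ₂[L] w₀.1.embedding))} (hC' : IsCompact C') (hφ0 : ∀ y, y ∉ C' → φ y = 0) :
    Integrable (fun z : ↥(unitaryGroupOfForm (starRingEnd ℂ) (Matrix.map Φ₂[L] w₀.1.embedding)) × ↥(unitaryGroupOfForm (starRingEnd ℂ) (Matrix.map Φ₂[L] w₀.1.embedding)) => φ (z.1 * (γ * z.2) * z.1⁻¹)) Λ' := by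
  haveI : SecondCountableTopology ↥(unitaryGroupOfForm (starRingEnd ℂ) (Matrix.map Φ₂[L] w₀.1.embedding)) := secondCountableTopology_unitaryGroupOfForm_complex _
  obtain ⟨𝒮, h𝒮c, h𝒮⟩ := hprop C' hC'
  have hcont : Continuous (fun z : ↥(unitaryGroupOfForm (starRingEnd ℂ) (Matrix.map Φ₂[L] w₀.1.embedding)) × ↥(unitaryGroupOfForm (starRingEnd ℂ) (Matrix.map Φ₂[L] w₀.1.embedding)) => φ (z.1 * (γ * z.2) * z.1⁻¹)) :=
    hφ.comp ((continuous_fst.mul (continuous_const.mul continuous_snd)).mul continuous_fst.inv)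
  refine (hcont.continuousOn.integrableOn_compact h𝒮c).integrable_of_ae_notMem_eq_zero ?_
  have hZ : ∀ᵐ z ∂Λ', z ∈ Z' := by
    rw [ae_iff]
    simpa only [Set.compl_def] using hZ'null
  filter_upwards [hZ] with z hz hz𝒮
  by_contra hne
  exact hz𝒮 (h𝒮 z hz (by_contra fun hmem => hne (hφ0 _ hmem)))

/-! ### §1b Elementary identities: the wall at `w₀` from `sin`, the cofactor split, the centre cancellation -/

omit [NumberField L] in
/-- `sin((a − b)∕2) ≠ 0 ⇒ e^{ia} ≠ e^{ib}` (if `e^{ia} = e^{ib}` then `a − b ∈ 2πℤ`). [cite: Shelstad1979, §4 p. 22] -/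
theorem circleExp_ne_of_sin_half_sub_ne_zero {a b : ℝ} (h : Real.sin ((a - b) / 2) ≠ 0) : Circle.exp a ≠ Circle.exp b := by
  intro heq
  obtain ⟨m, hm⟩ := Circle.exp_eq_exp.1 heq
  apply h
  rw [show (a - b) / 2 = (m : ℝ) * Real.pi by rw [hm]; ring]
  exact Real.sin_int_mul_pi m

/-- **The cofactor split on the compact chart**: `archERho S c · E_S(c) = 2i sin((c_{w₀}0 − c_{w₀}2)∕2) · PF(c)`, `PF` the product of the factors at `w ≠ w₀` (`w₀ ∉ S`;
`e^{iψ}(1 − e^{−2iψ}) = 2i sin ψ`). [cite: Shelstad1979, §4 p. 24] [cite: Bouaziz1994IntegralesOrbitales, §6.2 p. 591] -/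
theorem archERho_mul_expProd_eq (S : Finset {w : InfinitePlace L // IsComplex w}) (hw₀ : w₀ ∉ S) (c : {w : InfinitePlace L // IsComplex w} → Fin 3 → ℝ) :
    archERho S c * (∏ w, (if w ∈ S then ((Real.exp (c w 0) : ℝ) : ℂ) else 1 - (Circle.exp (c w 2 - c w 0) : ℂ))) = (2 * Complex.I * Real.sin ((c w₀ 0 - c w₀ 2) / 2)) * (∏ w ∈ Finset.univ.erase w₀, ((if w ∈ S then (1 : ℂ) else (Circle.exp (((c) w 0 - (c) w 2) / 2) : ℂ)) * (if w ∈ S then ((Real.exp ((c) w 0) : ℝ) : ℂ) else 1 - (Circle.exp ((c) w 2 - (c) w 0) : ℂ)))) := by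
  rw [archERho, ← Finset.prod_mul_distrib, ← Finset.mul_prod_erase Finset.univ _ (Finset.mem_univ w₀), if_neg hw₀, if_neg hw₀, mul_sub, mul_one,
    ← Circle.coe_mul, ← Circle.exp_add, show (c w₀ 0 - c w₀ 2) / 2 + (c w₀ 2 - c w₀ 0) = -((c w₀ 0 - c w₀ 2) / 2) by ring, coe_circleExp_sub_coe_circleExp_neg]

/-- **The cofactor split on the split chart**: `archERho (insert w₀ S) c · E_{insert w₀ S}(c) = e^{x} · PF(c)` (`x = c w₀ 0`; at `w ≠ w₀`, `w ∈ insert w₀ S ↔ w ∈ S`).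
[cite: Shelstad1979, §4 p. 24] [cite: Bouaziz1994IntegralesOrbitales, §6.2 p. 591] -/
theorem archERho_insert_mul_expProd_eq (S : Finset {w : InfinitePlace L // IsComplex w}) (c : {w : InfinitePlace L // IsComplex w} → Fin 3 → ℝ) :
    archERho (insert w₀ S) c * (∏ w, (if w ∈ insert w₀ S then ((Real.exp (c w 0) : ℝ) : ℂ) else 1 - (Circle.exp (c w 2 - c w 0) : ℂ))) = ((Real.exp (c w₀ 0) : ℝ) : ℂ) * (∏ w ∈ Finset.univ.erase w₀, ((if w ∈ S then (1 : ℂ) else (Circle.exp (((c) w 0 - (c) w 2) / 2) : ℂ)) * (if w ∈ S then ((Real.exp ((c) w 0) : ℝ) : ℂ) else 1 - (Circle.exp ((c) w 2 - (c) w 0) : ℂ)))) := by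
  rw [archERho, ← Finset.prod_mul_distrib, ← Finset.mul_prod_erase Finset.univ _ (Finset.mem_univ w₀), if_pos (Finset.mem_insert_self w₀ S),
    if_pos (Finset.mem_insert_self w₀ S), one_mul]
  congr 1
  refine Finset.prod_congr rfl fun w hw => ?_
  have hne : w ≠ w₀ := Finset.ne_of_mem_erase hw
  simp only [Finset.mem_insert, hne, false_or]

/-- `PF` only sees the places `w ≠ w₀`. [cite: Shelstad1979, §4 p. 24] -/
theorem expProd_congr_off (S : Finset {w : InfinitePlace L // IsComplex w}) (c c' : {w : InfinitePlace L // IsComplex w} → Fin 3 → ℝ) (h : ∀ w, w ≠ w₀ → c w = c' w) :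
    (∏ w ∈ Finset.univ.erase w₀, ((if w ∈ S then (1 : ℂ) else (Circle.exp (((c) w 0 - (c) w 2) / 2) : ℂ)) * (if w ∈ S then ((Real.exp ((c) w 0) : ℝ) : ℂ) else 1 - (Circle.exp ((c) w 2 - (c) w 0) : ℂ)))) = (∏ w ∈ Finset.univ.erase w₀, ((if w ∈ S then (1 : ℂ) else (Circle.exp (((c') w 0 - (c') w 2) / 2) : ℂ)) * (if w ∈ S then ((Real.exp ((c') w 0) : ℝ) : ℂ) else 1 - (Circle.exp ((c') w 2 - (c') w 0) : ℂ)))) := by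
  refine Finset.prod_congr rfl fun w hw => ?_
  rw [h w (Finset.ne_of_mem_erase hw)]

include hJ in
omit [NumberField L] in
/-- **The centre cancels the phase of the split torus point**: `e^{−iθ} • ↑↑(k · (t_{0,θ} X) · k⁻¹) = ↑↑(k · (t_{0,0} X) · k⁻¹)` (`t_{0,θ} = e^{iθ}·1`).
[cite: Rogawski1990, §3.6 p. 31; §8.2 p. 119] -/
theorem inv_coe_circleExp_smul_coe_conj_hypBlockGL_zero (k a b a' : ↥(unitaryGroupOfForm (starRingEnd ℂ) (Matrix.map Φ₂[L] w₀.1.embedding))) (θ : ℝ) :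
    ((Circle.exp θ : ℂ))⁻¹ • (((k * ((⟨hypBlockGL (0) (θ), hypBlockGL_mem_of_eq_over hJ (0) (θ)⟩ : ↥(unitaryGroupOfForm (starRingEnd ℂ) (Matrix.map Φ₂[L] w₀.1.embedding))) * a * b * a') * k⁻¹ : ↥(unitaryGroupOfForm (starRingEnd ℂ) (Matrix.map Φ₂[L] w₀.1.embedding))) : GL (Fin 2) ℂ) : Matrix (Fin 2) (Fin 2) ℂ) =
      (((k * ((⟨hypBlockGL (0) (0), hypBlockGL_mem_of_eq_over hJ (0) (0)⟩ : ↥(unitaryGroupOfForm (starRingEnd ℂ) (Matrix.map Φ₂[L] w₀.1.embedding))) * a * b * a') * k⁻¹ : ↥(unitaryGroupOfForm (starRingEnd ℂ) (Matrix.map Φ₂[L] w₀.1.embedding))) : GL (Fin 2) ℂ) : Matrix (Fin 2) (Fin 2) ℂ) := by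
  have h0 : ∀ θ' : ℝ, ((hypBlockGL 0 θ' : GL (Fin 2) ℂ) : Matrix (Fin 2) (Fin 2) ℂ) = Complex.exp ((θ' : ℂ) * Complex.I) • (1 : Matrix (Fin 2) (Fin 2) ℂ) := fun θ' => by
    rw [coe_hypBlockGL]
    ext i j
    fin_cases i <;> fin_cases j <;> simp
  simp only [Subgroup.coe_mul, Units.val_mul, h0, Matrix.smul_mul, Matrix.mul_smul, Matrix.one_mul, smul_smul, Circle.coe_exp, Complex.ofReal_zero, zero_mul,
    Complex.exp_zero, one_smul, inv_mul_cancel₀ (Complex.exp_ne_zero _)]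

end Integrability

/-! ## §2 The package -/

section Package

variable (L : Type) [Field L] [NumberField L]
  (S : Finset {w : InfinitePlace L // IsComplex w}) (w₀ : {w : InfinitePlace L // IsComplex w})
  (hJ : Matrix.map Φ₂[L] w₀.1.embedding = (StdForm.antidiagonal 2).over ℂ)
  [MeasurableSpace ↥(unitaryGroupOfForm (starRingEnd ℂ) (Matrix.map Φ₂[L] w₀.1.embedding))] [BorelSpace ↥(unitaryGroupOfForm (starRingEnd ℂ) (Matrix.map Φ₂[L] w₀.1.embedding))]

set_option maxHeartbeats 800000 in
include hJ in
/-- **THE TWO-CHART DESCENT PACKAGE FOR THE STABLE FAMILY (`hdesc₁ ∧ hdesc₂` of ★ 2b, ODD-ISED compact reader).**  Data: the wall `(S, w₀)`, `w₀ ∉ S`; the centre-one Cayley reader `Φ₁`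
on `U(Φ₂)_{w₀}` against `ν₀` (`hΦ₁`) and the `K × N` half-chart reader `Φ₂` at `θ = 0` (`hΦ₂`); two families `Ψ` (chart `S`) and `Ψ′` (chart `insert w₀ S`) with their flip-sum MODELS
`hΨ`, `hΨ′` through per-chart integrals `I`, `I′` (★ (c) ∕ (JH-A)), `Ψ′` continuous on `InRegS`; the WALL-SET REPRESENTATION `hrep` ((JH-B), `m = 0`: for every compact set of regular base
points ONE `E′`-valued smooth compactly-supported `g`, constant along `nrm w₀`, with `I = ℓ ∫ g(·, orbit)` on the compact chart and `I′ = ℓ ∫ g(ĉ′, e^{−iθ} • conj) dΛ′` on the split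
chart); the split leaf `Λ′` (carried by `Z′`, uniformly proper at `γ′`) and its HALF-CHART CONVERSION `hhalf` ((JH-A′): constant `Ch`, factor `e^{−x}`, `x ≠ 0`).  THEN near a wall point
`p` (`p w₀ 0 = p w₀ 2`, regular at the other compact places): `∃ U₁ U₂ G`, open neighbourhoods of `p` ∕ `hcCayPt w₀ 0 2 p`, an admissible ℂ-valued family `G` (jointly `C^∞`, one compact
support), the smooth ν-free cofactor `PF`, with ★ 2b's `hdesc₁` for `F₁ = archERho S · Ψ` (odd-ised reader, `K₁ = I·K₀`) off the wall on `U₁` and `hdesc₂` for `F₂ = archERho S′ · Ψ′`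
(`K₂ = K₀′·Ch`) on ALL of `U₂` (through the real wall by continuity). [cite: Shelstad1979, §4 pp. 22–25; Lemma 4.3 p. 25] [cite: Bouaziz1994IntegralesOrbitales, §3.2 (I₃) p. 580; §6.2 p. 591]
[cite: Rogawski1990, §8.2 pp. 119–123; §4.1 (4.1.1) p. 39] [cite: Varadarajan1989, §6.4 Lemma 21, Thm 23] -/
theorem exists_twoChart_descent_of_representation (hw₀ : w₀ ∉ S)
    (ν₀ : Measure ↥(unitaryGroupOfForm (starRingEnd ℂ) (Matrix.map Φ₂[L] w₀.1.embedding))) [IsFiniteMeasureOnCompacts ν₀]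
    -- the centre-one Cayley elliptic reader on `U(Φ₂)_{w₀}`
    (Φ₁ : (Matrix (Fin 2) (Fin 2) ℂ → ℂ) → ℝ → ℂ)
    (hΦ₁ : ∀ (f : Matrix (Fin 2) (Fin 2) ℂ → ℂ) (ψ : ℝ), Φ₁ f ψ = (2 * Real.sin ψ) • ∫ h : ↥(unitaryGroupOfForm (starRingEnd ℂ) (Matrix.map Φ₂[L] w₀.1.embedding)), f (((h * ⟨Matrix.GeneralLinearGroup.mkOfDetNeZero !![(1 : ℂ), 1; 1, -1] det_cayleyTwo_ne_zero * circleDiagonal 2 ![1 * Circle.exp (ψ), 1 * Circle.exp (-(ψ))] * (Matrix.GeneralLinearGroup.mkOfDetNeZero !![(1 : ℂ), 1; 1, -1] det_cayleyTwo_ne_zero)⁻¹, cayley_conj_circleDiagonal_mem_of_eq_over hJ _⟩ * h⁻¹ : ↥(unitaryGroupOfForm (starRingEnd ℂ) (Matrix.map Φ₂[L] w₀.1.embedding))) : GL (Fin 2) ℂ) : Matrix (Fin 2) (Fin 2) ℂ) ∂ν₀)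
    -- the `K × N` half-chart reader at `θ = 0`
    {K : Subgroup ↥(unitaryGroupOfForm (starRingEnd ℂ) (Matrix.map Φ₂[L] w₀.1.embedding))} (κK : Measure ↥K) (μN : Measure ↥(unipotentU (starRingEnd ℂ) (Matrix.map Φ₂[L] w₀.1.embedding))) (hK : IsCompact (K : Set ↥(unitaryGroupOfForm (starRingEnd ℂ) (Matrix.map Φ₂[L] w₀.1.embedding)))) [κK.IsHaarMeasure] [μN.IsHaarMeasure]
    (Φ₂ : (Matrix (Fin 2) (Fin 2) ℂ → ℂ) → ℝ → ℂ)
    (hΦ₂ : ∀ (f : Matrix (Fin 2) (Fin 2) ℂ → ℂ) (x : ℝ), Φ₂ f x = ∫ p : ↥K × ↥(unipotentU (starRingEnd ℂ) (Matrix.map Φ₂[L] w₀.1.embedding)), f ((((((p.1 : ↥K) : ↥(unitaryGroupOfForm (starRingEnd ℂ) (Matrix.map Φ₂[L] w₀.1.embedding))) * (((⟨hypBlockGL (0) (0), hypBlockGL_mem_of_eq_over hJ (0) (0)⟩ : ↥(unitaryGroupOfForm (starRingEnd ℂ) (Matrix.map Φ₂[L] w₀.1.embedding)))) * ((⟨hypBlockGL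 ((x) / 2) (0), hypBlockGL_mem_of_eq_over hJ ((x) / 2) (0)⟩ : ↥(unitaryGroupOfForm (starRingEnd ℂ) (Matrix.map Φ₂[L] w₀.1.embedding)))) * ((p.2 : ↥(unipotentU (starRingEnd ℂ) (Matrix.map Φ₂[L] w₀.1.embedding))) : ↥(unitaryGroupOfForm (starRingEnd ℂ) (Matrix.map Φ₂[L] w₀.1.embedding))) * ((⟨hypBlockGL ((x) / 2) (0), hypBlockGL_mem_of_eq_over hJ ((x) / 2) (0)⟩ : ↥(unitaryGroupOfForm (starRingEnd ℂ) (Matrix.map Φ₂[L] w₀.1.embedding))))) * ((p.1 : ↥K) : ↥(unitaryGroupOfForm (starRingEnd ℂ) (Matrix.map Φ₂[L] w₀.1.embedding)))⁻¹ : ↥(unitaryGroupOfForm (starRingEnd ℂ) (Matrix.map Φ₂[L] w₀.1.embedding)))) : GL (Fin 2) ℂ) : Matrix (Fin 2) (Fin 2) ℂ) ∂(κK.prod μN))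
    -- the two families and their flip-sum models (★ (c) for the charts `S` and `insert w₀ S`)
    (K₀ K₀' : ℝ) (I I' Ψ Ψ' : ({w : InfinitePlace L // IsComplex w} → Fin 3 → ℝ) → ℂ)
    (hΨ : ∀ c ∈ InRegS S, Ψ c = (K₀ : ℂ) * (∏ w, (if w ∈ S then ((Real.exp (c w 0) : ℝ) : ℂ) else 1 - (Circle.exp (c w 2 - c w 0) : ℂ))) * ∑ T ∈ (Finset.univ \ S).powerset, I (flipSet T c))
    (hΨ' : ∀ c ∈ InRegS (insert w₀ S), Ψ' c = (K₀' : ℂ) * (∏ w, (if w ∈ insert w₀ S then ((Real.exp (c w 0) : ℝ) : ℂ) else 1 - (Circle.exp (c w 2 - c w 0) : ℂ))) * ∑ T ∈ (Finset.univ \ insert w₀ S).powerset, I' (flipSet T c))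
    (hΨ'c : ContinuousOn Ψ' (InRegS (insert w₀ S)))
    -- the split leaf at `w₀` and its torus curve
    (γ' : (Fin 3 → ℝ) → ↥(unitaryGroupOfForm (starRingEnd ℂ) (Matrix.map Φ₂[L] w₀.1.embedding))) (Λ' : Measure (↥(unitaryGroupOfForm (starRingEnd ℂ) (Matrix.map Φ₂[L] w₀.1.embedding)) × ↥(unitaryGroupOfForm (starRingEnd ℂ) (Matrix.map Φ₂[L] w₀.1.embedding)))) [IsFiniteMeasureOnCompacts Λ'] (Z' : Set (↥(unitaryGroupOfForm (starRingEnd ℂ) (Matrix.map Φ₂[L] w₀.1.embedding)) × ↥(unitaryGroupOfForm (starRingEnd ℂ) (Matrix.map Φ₂[L] w₀.1.embedding)))) (hZ'null : Λ' Z'ᶜ = 0)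
    (hprop' : ∀ U : Set ({w : InfinitePlace L // IsComplex w} → Fin 3 → ℝ), IsCompact U → ∀ C' : Set ↥(unitaryGroupOfForm (starRingEnd ℂ) (Matrix.map Φ₂[L] w₀.1.embedding)), IsCompact C' →
      ∃ 𝒮 : Set (↥(unitaryGroupOfForm (starRingEnd ℂ) (Matrix.map Φ₂[L] w₀.1.embedding)) × ↥(unitaryGroupOfForm (starRingEnd ℂ) (Matrix.map Φ₂[L] w₀.1.embedding))), IsCompact 𝒮 ∧ ∀ z ∈ Z', ∀ c ∈ U, z.1 * (γ' (c w₀) * z.2) * z.1⁻¹ ∈ C' → z ∈ 𝒮)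
    -- the wall-set representation ((JH-B) at `m = 0`), for every compact set of base points regular at the compact places off `w₀`
    {Xam : Type*} [TopologicalSpace Xam]
    (hrep : ∀ C₁ : Set ({w : InfinitePlace L // IsComplex w} → Fin 3 → ℝ), IsCompact C₁ →
      (∀ c ∈ C₁, ∀ w, w ∉ S → w ≠ w₀ → Circle.exp (c w 0) ≠ Circle.exp (c w 2)) →
      ∃ (𝒮 : Set Xam) (Kmat : Set (Matrix (Fin 2) (Fin 2) ℂ)) (g : ({w : InfinitePlace L // IsComplex w} → Fin 3 → ℝ) × Matrix (Fin 2) (Fin 2) ℂ → (↥𝒮 →ᵇ ℂ))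
        (ℓ : (↥𝒮 →ᵇ ℂ) →L[ℝ] ℂ),
        IsCompact 𝒮 ∧ IsCompact Kmat ∧ ContDiff ℝ ∞ g ∧ (∀ c Y, Y ∉ Kmat → g (c, Y) = 0) ∧
        (∀ (c : {w : InfinitePlace L // IsComplex w} → Fin 3 → ℝ) (s : ℝ) (Y : Matrix (Fin 2) (Fin 2) ℂ), g (c + s • nrm w₀, Y) = g (c, Y)) ∧
        (∀ c ∈ C₁ ∩ InRegS S, I c = ℓ (∫ h : ↥(unitaryGroupOfForm (starRingEnd ℂ) (Matrix.map Φ₂[L] w₀.1.embedding)), g (c, (((h * ⟨Matrix.GeneralLinearGroup.mkOfDetNeZero !![(1 : ℂ), 1; 1, -1] det_cayleyTwo_ne_zero * circleDiagonal 2 ![1 * Circle.exp (((c w₀ 0 - c w₀ 2) / 2)), 1 * Circle.exp (-(((c w₀ 0 - c w₀ 2) / 2)))] * (Matrix.GeneralLinearGroup.mkOfDetNeZero !![(1 : ℂ), 1; 1, -1] det_cayleyTwo_ne_zero)⁻¹, cayley_conj_circleDiagonal_mem_of_eq_over hJ _⟩ * h⁻¹ : ↥(unitaryGroupOfForm (starRingEnd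 ℂ) (Matrix.map Φ₂[L] w₀.1.embedding))) : GL (Fin 2) ℂ) : Matrix (Fin 2) (Fin 2) ℂ)) ∂ν₀)) ∧
        (∀ c : {w : InfinitePlace L // IsComplex w} → Fin 3 → ℝ, (Function.update c w₀ ![c w₀ 2, c w₀ 1, c w₀ 2]) ∈ C₁ →
          I' c = ℓ (∫ z : ↥(unitaryGroupOfForm (starRingEnd ℂ) (Matrix.map Φ₂[L] w₀.1.embedding)) × ↥(unitaryGroupOfForm (starRingEnd ℂ) (Matrix.map Φ₂[L] w₀.1.embedding)), g ((Function.update c w₀ ![c w₀ 2, c w₀ 1, c w₀ 2]),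
            ((Circle.exp (c w₀ 2) : ℂ))⁻¹ • (((z.1 * (γ' (c w₀) * z.2) * z.1⁻¹ : ↥(unitaryGroupOfForm (starRingEnd ℂ) (Matrix.map Φ₂[L] w₀.1.embedding))) : GL (Fin 2) ℂ) : Matrix (Fin 2) (Fin 2) ℂ)) ∂Λ')))
    -- the split leaf in half-chart currency ((JH-A′))
    (Ch : ℝ)
    (hhalf : ∀ Gf : ↥(unitaryGroupOfForm (starRingEnd ℂ) (Matrix.map Φ₂[L] w₀.1.embedding)) → ℂ, Continuous Gf → HasCompactSupport Gf → ∀ c : {w : InfinitePlace L // IsComplex w} → Fin 3 → ℝ, c w₀ 0 ≠ 0 →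
      ∫ z : ↥(unitaryGroupOfForm (starRingEnd ℂ) (Matrix.map Φ₂[L] w₀.1.embedding)) × ↥(unitaryGroupOfForm (starRingEnd ℂ) (Matrix.map Φ₂[L] w₀.1.embedding)), Gf (z.1 * (γ' (c w₀) * z.2) * z.1⁻¹) ∂Λ' =
        ((Ch * Real.exp (-(c w₀ 0)) : ℝ)) • ∫ p : ↥K × ↥(unipotentU (starRingEnd ℂ) (Matrix.map Φ₂[L] w₀.1.embedding)), Gf (((((p.1 : ↥K) : ↥(unitaryGroupOfForm (starRingEnd ℂ) (Matrix.map Φ₂[L] w₀.1.embedding))) * (((⟨hypBlockGL (0) (c w₀ 2), hypBlockGL_mem_of_eq_over hJ (0) (c w₀ 2)⟩ : ↥(unitaryGroupOfForm (starRingEnd ℂ) (Matrix.map Φ₂[L] w₀.1.embedding)))) * ((⟨hypBlockGL ((c w₀ 0) / 2) (0), hypBlockGL_mem_of_eq_over hJ ((c w₀ 0) / 2) (0)⟩ : ↥(unitaryGroupOfForm (starRingEnd ℂ) (Matrix.map Φ₂[L] w₀.1.embedding)))) * ((p.2 : ↥(unipotentU (starRingEnd ℂ) (Matrix.map Φ₂[L]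 w₀.1.embedding))) : ↥(unitaryGroupOfForm (starRingEnd ℂ) (Matrix.map Φ₂[L] w₀.1.embedding))) * ((⟨hypBlockGL ((c w₀ 0) / 2) (0), hypBlockGL_mem_of_eq_over hJ ((c w₀ 0) / 2) (0)⟩ : ↥(unitaryGroupOfForm (starRingEnd ℂ) (Matrix.map Φ₂[L] w₀.1.embedding))))) * ((p.1 : ↥K) : ↥(unitaryGroupOfForm (starRingEnd ℂ) (Matrix.map Φ₂[L] w₀.1.embedding)))⁻¹ : ↥(unitaryGroupOfForm (starRingEnd ℂ) (Matrix.map Φ₂[L] w₀.1.embedding)))) ) ∂(κK.prod μN))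
    -- the wall point
    {p : {w : InfinitePlace L // IsComplex w} → Fin 3 → ℝ} (hp : p w₀ 0 = p w₀ 2)
    (hpreg : ∀ w, w ∉ S → w ≠ w₀ → Circle.exp (p w 0) ≠ Circle.exp (p w 2)) :
    ∃ (U₁ U₂ : Set ({w : InfinitePlace L // IsComplex w} → Fin 3 → ℝ)) (G : ({w : InfinitePlace L // IsComplex w} → Fin 3 → ℝ) → Matrix (Fin 2) (Fin 2) ℂ → ℂ),
      IsOpen U₁ ∧ p ∈ U₁ ∧ IsOpen U₂ ∧ hcCayPt w₀ 0 2 p ∈ U₂ ∧ ContDiff ℝ ∞ (Function.uncurry G) ∧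
      (∃ C : Set (Matrix (Fin 2) (Fin 2) ℂ), IsCompact C ∧ ∀ (q : {w : InfinitePlace L // IsComplex w} → Fin 3 → ℝ) (X : Matrix (Fin 2) (Fin 2) ℂ), X ∉ C → G q X = 0) ∧
      ContDiff ℝ ∞ (fun q : {w : InfinitePlace L // IsComplex w} → Fin 3 → ℝ => (∏ w ∈ Finset.univ.erase w₀, ((if w ∈ S then (1 : ℂ) else (Circle.exp (((q) w 0 - (q) w 2) / 2) : ℂ)) * (if w ∈ S then ((Real.exp ((q) w 0) : ℝ) : ℂ) else 1 - (Circle.exp ((q) w 2 - (q) w 0) : ℂ))))) ∧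
      (∀ c ∈ U₁, ((c w₀ 0 - c w₀ 2) / 2) ∈ {ψ : ℝ | Real.sin ψ ≠ 0} →
        archERho S c * Ψ c = (Complex.I * K₀) * ((1 : ℂ) * (∏ w ∈ Finset.univ.erase w₀, ((if w ∈ S then (1 : ℂ) else (Circle.exp ((((c - ((c w₀ 0 - c w₀ 2) / 2) • hcNrm w₀ 0 2)) w 0 - ((c - ((c w₀ 0 - c w₀ 2) / 2) • hcNrm w₀ 0 2)) w 2) / 2) : ℂ)) * (if w ∈ S then ((Real.exp (((c - ((c w₀ 0 - c w₀ 2) / 2) • hcNrm w₀ 0 2)) w 0) : ℝ) : ℂ) else 1 - (Circle.exp (((c - ((c w₀ 0 - c w₀ 2) / 2) • hcNrm w₀ 0 2)) w 2 - ((c - ((c w₀ 0 - c w₀ 2) / 2) • hcNrm w₀ 0 2)) w 0) : ℂ)))) - 0) *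
          (Φ₁ (G (c - ((c w₀ 0 - c w₀ 2) / 2) • hcNrm w₀ 0 2)) ((c w₀ 0 - c w₀ 2) / 2) - Φ₁ (G (c - ((c w₀ 0 - c w₀ 2) / 2) • hcNrm w₀ 0 2)) (-((c w₀ 0 - c w₀ 2) / 2)))) ∧
      (∀ c ∈ U₂, archERho (insert w₀ S) c * Ψ' c = ((K₀' * Ch : ℝ) : ℂ) * ((1 : ℂ) * (∏ w ∈ Finset.univ.erase w₀, ((if w ∈ S then (1 : ℂ) else (Circle.exp ((((Function.update c w₀ (fun s => if s = hcThird 0 2 then c w₀ 1 else c w₀ 2))) w 0 - ((Function.update c w₀ (fun s => if s = hcThird 0 2 then c w₀ 1 else c w₀ 2))) w 2) / 2) : ℂ)) * (if w ∈ S then ((Real.exp (((Function.update c w₀ (fun s => if s = hcThird 0 2 then c w₀ 1 else c w₀ 2))) w 0) : ℝ) : ℂ) else 1 - (Circle.exp (((Function.update c w₀ (fun s => if s = hcThird 0 2 then c w₀ 1 else c w₀ 2))) w 2 - ((Function.update c w₀ (fun s => if s = hcThird 0 2 then c w₀ 1 else c w₀ 2))) w 0) : ℂ)))) - 0) * Φ₂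 (G (Function.update c w₀ (fun s => if s = hcThird 0 2 then c w₀ 1 else c w₀ 2))) (c w₀ 0)) := by
  -- ═══ Step 0: a closed ball of base points regular at the compact places off `w₀`, and the flip-stable compact `C₁`
  have hO : IsOpen {c : {w : InfinitePlace L // IsComplex w} → Fin 3 → ℝ | ∀ w, w ∉ S → w ≠ w₀ → Circle.exp (c w 0) ≠ Circle.exp (c w 2)} := by
    have hcoordc : ∀ (w : {w : InfinitePlace L // IsComplex w}) (k : Fin 3), Continuous fun c : {w : InfinitePlace L // IsComplex w} → Fin 3 → ℝ => c w k := fun w k => (continuous_apply k).comp (continuous_apply w)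
    have he : {c : {w : InfinitePlace L // IsComplex w} → Fin 3 → ℝ | ∀ w, w ∉ S → w ≠ w₀ → Circle.exp (c w 0) ≠ Circle.exp (c w 2)} =
        ⋂ w ∈ (Finset.univ.filter fun w : {w : InfinitePlace L // IsComplex w} => w ∉ S ∧ w ≠ w₀), {c | Circle.exp (c w 0) ≠ Circle.exp (c w 2)} := by
      ext c
      simp only [Set.mem_setOf_eq, Set.mem_iInter, Finset.mem_filter, Finset.mem_univ, true_and, and_imp]
    rw [he]
    exact isOpen_biInter_finset fun w _ => isOpen_ne_fun (Circle.exp.continuous.comp (hcoordc w 0)) (Circle.exp.continuous.comp (hcoordc w 2))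
  obtain ⟨r₀, hr₀, hball₀⟩ := Metric.isOpen_iff.1 hO p hpreg
  obtain ⟨r, hr, hrr₀⟩ : ∃ r : ℝ, 0 < r ∧ r < r₀ := ⟨r₀ / 2, by positivity, by linarith⟩
  have hclosed : ∀ c ∈ Metric.closedBall p r, ∀ w, w ∉ S → w ≠ w₀ → Circle.exp (c w 0) ≠ Circle.exp (c w 2) :=
    fun c hc => hball₀ (Metric.closedBall_subset_ball hrr₀ hc)
  have hflipA : ∀ T : Finset {w : InfinitePlace L // IsComplex w}, ∃ A : ({w : InfinitePlace L // IsComplex w} → Fin 3 → ℝ) →L[ℝ] ({w : InfinitePlace L // IsComplex w} → Fin 3 → ℝ), (flipSet T : ({w : InfinitePlace L // IsComplex w} → Fin 3 → ℝ) → ({w : InfinitePlace L // IsComplex w} → Fin 3 → ℝ)) = ⇑A := by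
    intro T
    refine ⟨LinearMap.toContinuousLinearMap
      { toFun := flipSet T
        map_add' := fun a b => ?_
        map_smul' := fun r' a => ?_ }, rfl⟩
    · funext w j
      simp only [flipSet, Pi.add_apply]
      split_ifs with h
      · fin_cases j <;> simp
      · rfl
    · funext w j
      simp only [flipSet, Pi.smul_apply, smul_eq_mul, RingHom.id_apply]
      split_ifs with h
      · fin_cases j <;> simp
      · rfl
  have hflipcont : ∀ T : Finset {w : InfinitePlace L // IsComplex w}, Continuous (flipSet T : ({w : InfinitePlace L // IsComplex w} → Fin 3 → ℝ) → ({w : InfinitePlace L // IsComplex w} → Fin 3 → ℝ)) := fun T => by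
    obtain ⟨A, hA⟩ := hflipA T; rw [hA]; exact A.continuous
  have hflipcd : ∀ T : Finset {w : InfinitePlace L // IsComplex w}, ContDiff ℝ ∞ (flipSet T : ({w : InfinitePlace L // IsComplex w} → Fin 3 → ℝ) → ({w : InfinitePlace L // IsComplex w} → Fin 3 → ℝ)) := fun T => by
    obtain ⟨A, hA⟩ := hflipA T; rw [hA]; exact A.contDiff
  obtain ⟨C₁, hC₁def⟩ : ∃ C₁ : Set ({w : InfinitePlace L // IsComplex w} → Fin 3 → ℝ), C₁ = ⋃ T : Finset {w : InfinitePlace L // IsComplex w}, flipSet T '' Metric.closedBall p r := ⟨_, rfl⟩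
  have hC₁c : IsCompact C₁ := by
    rw [hC₁def]
    exact isCompact_iUnion fun T => (isCompact_closedBall p r).image (hflipcont T)
  have hmemC₁ : ∀ (T : Finset {w : InfinitePlace L // IsComplex w}) (c : {w : InfinitePlace L // IsComplex w} → Fin 3 → ℝ), c ∈ Metric.closedBall p r → flipSet T c ∈ C₁ := fun T c hc => by
    rw [hC₁def]; exact Set.mem_iUnion.2 ⟨T, c, hc, rfl⟩
  have hC₁reg : ∀ c ∈ C₁, ∀ w, w ∉ S → w ≠ w₀ → Circle.exp (c w 0) ≠ Circle.exp (c w 2) := by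
    intro c hc w hwS hww
    rw [hC₁def] at hc
    obtain ⟨T, c₀, hc₀, rfl⟩ : ∃ (T : Finset {w : InfinitePlace L // IsComplex w}) (c₀ : {w : InfinitePlace L // IsComplex w} → Fin 3 → ℝ), c₀ ∈ Metric.closedBall p r ∧ flipSet T c₀ = c := by
      simpa only [Set.mem_iUnion, Set.mem_image] using hc
    have h0 := hclosed c₀ hc₀ w hwS hww
    by_cases hT : w ∈ T
    · rw [flipSet_apply_of_mem hT]
      simpa only [Matrix.cons_val_zero, Matrix.cons_val_two, Matrix.tail_cons, Matrix.head_cons] using h0.symm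
    · rw [flipSet_apply_of_not_mem hT]; exact h0
  -- ═══ Step 1: the wall-set representation on `C₁`
  obtain ⟨𝒮, Kmat, g, ℓ, -, hKmat, hg, hg0, hgn, hIrep, hI'rep⟩ := hrep C₁ hC₁c hC₁reg
  have hemb : IsClosedEmbedding (fun y : ↥(unitaryGroupOfForm (starRingEnd ℂ) (Matrix.map Φ₂[L] w₀.1.embedding)) => ((y : GL (Fin 2) ℂ) : Matrix (Fin 2) (Fin 2) ℂ)) :=
    isClosedEmbedding_coe_unitaryGroupOfForm_of_eq_over hJ
  -- smoothness tools for the cofactor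
  have hcoord : ∀ (w : {w : InfinitePlace L // IsComplex w}) (k : Fin 3), ContDiff ℝ ∞ fun q : {w : InfinitePlace L // IsComplex w} → Fin 3 → ℝ => q w k := fun w k => (contDiff_apply ℝ ℝ k).comp (contDiff_apply ℝ (Fin 3 → ℝ) w)
  have hcexp : ∀ {φ : ({w : InfinitePlace L // IsComplex w} → Fin 3 → ℝ) → ℝ}, ContDiff ℝ ∞ φ → ContDiff ℝ ∞ fun q => ((Circle.exp (φ q) : Circle) : ℂ) := fun {φ} hφ => by
    have he : (fun q => ((Circle.exp (φ q) : Circle) : ℂ)) = fun q => Complex.exp (((φ q : ℝ) : ℂ) * Complex.I) := funext fun q => Circle.coe_exp _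
    rw [he]
    exact Complex.contDiff_exp.comp ((Complex.ofRealCLM.contDiff.comp hφ).mul contDiff_const)
  have hPF : ContDiff ℝ ∞ (fun q : {w : InfinitePlace L // IsComplex w} → Fin 3 → ℝ => (∏ w ∈ Finset.univ.erase w₀, ((if w ∈ S then (1 : ℂ) else (Circle.exp (((q) w 0 - (q) w 2) / 2) : ℂ)) * (if w ∈ S then ((Real.exp ((q) w 0) : ℝ) : ℂ) else 1 - (Circle.exp ((q) w 2 - (q) w 0) : ℂ))))) := by
    refine contDiff_prod fun w _ => ContDiff.mul ?_ ?_
    · by_cases hw : w ∈ S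
      · simp only [if_pos hw]; exact contDiff_const
      · simp only [if_neg hw]; exact hcexp (((hcoord w 0).sub (hcoord w 2)).div_const 2)
    · by_cases hw : w ∈ S
      · simp only [if_pos hw]; exact Complex.ofRealCLM.contDiff.comp (Real.contDiff_exp.comp (hcoord w 0))
      · simp only [if_neg hw]; exact contDiff_const.sub (hcexp ((hcoord w 2).sub (hcoord w 0)))
  -- the two hats agree (`hcThird 0 2 = 1`)
  have h02 : hcThird 0 2 = 1 := by decide
  have hhat : ∀ c : {w : InfinitePlace L // IsComplex w} → Fin 3 → ℝ, (Function.update c w₀ (fun s => if s = hcThird 0 2 then c w₀ 1 else c w₀ 2)) = (Function.update c w₀ ![c w₀ 2, c w₀ 1, c w₀ 2]) := fun c => by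
    congr 1
    funext s
    fin_cases s <;> simp [h02]
  -- `hatB` and `hcCayPt`
  have hvec : Continuous fun c : {w : InfinitePlace L // IsComplex w} → Fin 3 → ℝ => (![c w₀ 2, c w₀ 1, c w₀ 2] : Fin 3 → ℝ) := by
    refine continuous_pi fun k => ?_
    have h2 : Continuous fun c : {w : InfinitePlace L // IsComplex w} → Fin 3 → ℝ => c w₀ 2 := (continuous_apply 2).comp (continuous_apply w₀)
    have h1 : Continuous fun c : {w : InfinitePlace L // IsComplex w} → Fin 3 → ℝ => c w₀ 1 := (continuous_apply 1).comp (continuous_apply w₀)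
    fin_cases k
    · exact h2
    · exact h1
    · exact h2
  have hhatcont : Continuous fun c : {w : InfinitePlace L // IsComplex w} → Fin 3 → ℝ => (Function.update c w₀ ![c w₀ 2, c w₀ 1, c w₀ 2]) := continuous_id.update w₀ hvec
  -- ═══ Step 2: the admissible family `G`
  refine ⟨Metric.ball p r, {c | (Function.update c w₀ ![c w₀ 2, c w₀ 1, c w₀ 2]) ∈ Metric.ball p r},
    fun q X => ∑ T ∈ (Finset.univ \ insert w₀ S).powerset, ℓ (g (flipSet T q, X)),
    Metric.isOpen_ball, Metric.mem_ball_self hr, Metric.isOpen_ball.preimage hhatcont, ?_, ?_, ?_, hPF, ?_, ?_⟩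
  · -- `ĉ(hcCayPt p) = p`
    show (Function.update (hcCayPt w₀ 0 2 p) w₀ ![hcCayPt w₀ 0 2 p w₀ 2, hcCayPt w₀ 0 2 p w₀ 1, hcCayPt w₀ 0 2 p w₀ 2]) ∈ Metric.ball p r
    have he : Function.update (hcCayPt w₀ 0 2 p) w₀ ![hcCayPt w₀ 0 2 p w₀ 2, hcCayPt w₀ 0 2 p w₀ 1, hcCayPt w₀ 0 2 p w₀ 2] = p := by
      rw [hcCayPt, Function.update_idem]
      conv_rhs => rw [← Function.update_eq_self w₀ p]
      congr 1
      funext s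
      fin_cases s <;> simp [h02, hp]
    rw [he]
    exact Metric.mem_ball_self hr
  · -- `G` is jointly `C^∞`
    exact ContDiff.sum fun T _ => ℓ.contDiff.comp (hg.comp (((hflipcd T).comp contDiff_fst).prodMk contDiff_snd))
  · -- ONE compact support
    exact ⟨Kmat, hKmat, fun q X hX => Finset.sum_eq_zero fun T _ => by rw [hg0 _ _ hX, map_zero]⟩
  · -- ═══ Step 3: `hdesc₁` — the compact chart, off the wall
    intro c hc hsin
    simp only [Set.mem_setOf_eq] at hsin
    have hcb : c ∈ Metric.closedBall p r := Metric.ball_subset_closedBall hc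
    have hcin : c ∈ InRegS S := by
      intro w hwS
      by_cases hww : w = w₀
      · subst hww; exact circleExp_ne_of_sin_half_sub_ne_zero hsin
      · exact hclosed c hcb w hwS hww
    -- flips
    have hPS : ∀ T ∈ (Finset.univ \ insert w₀ S).powerset, w₀ ∉ T := fun T hT h =>
      (Finset.mem_sdiff.1 (Finset.mem_powerset.1 hT h)).2 (Finset.mem_insert_self w₀ S)
    have hnrm : hcNrm w₀ 0 2 = nrm w₀ := by
      funext w k
      simp only [hcNrm, nrm]
      by_cases hw : w = w₀
      · subst hw; fin_cases k <;> simp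
      · simp [Pi.single_eq_of_ne hw]
    have key1 : ∀ T : Finset {w : InfinitePlace L // IsComplex w}, w₀ ∉ T → flipSet T c = flipSet T (c - ((c w₀ 0 - c w₀ 2) / 2) • hcNrm w₀ 0 2) + ((c w₀ 0 - c w₀ 2) / 2) • nrm w₀ := by
      intro T hT
      funext w k
      simp only [Pi.add_apply, Pi.smul_apply, smul_eq_mul, hnrm, nrm]
      by_cases hw : w = w₀
      · subst hw
        rw [flipSet_apply_of_not_mem hT, flipSet_apply_of_not_mem hT]
        simp only [Pi.sub_apply, Pi.smul_apply, Pi.single_eq_same, smul_eq_mul]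
        ring
      · by_cases hwT : w ∈ T
        · rw [flipSet_apply_of_mem hwT, flipSet_apply_of_mem hwT]
          fin_cases k <;> simp [Pi.single_eq_of_ne hw]
        · rw [flipSet_apply_of_not_mem hwT, flipSet_apply_of_not_mem hwT]
          simp [Pi.single_eq_of_ne hw]
    have key2 : ∀ T : Finset {w : InfinitePlace L // IsComplex w}, w₀ ∉ T → flipSet (insert w₀ T) c = flipSet T (c - ((c w₀ 0 - c w₀ 2) / 2) • hcNrm w₀ 0 2) + (-((c w₀ 0 - c w₀ 2) / 2)) • nrm w₀ := by
      intro T hT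
      funext w k
      simp only [Pi.add_apply, Pi.smul_apply, smul_eq_mul, hnrm, nrm]
      by_cases hw : w = w₀
      · subst hw
        rw [flipSet_apply_of_mem (Finset.mem_insert_self _ _), flipSet_apply_of_not_mem hT]
        simp only [Pi.sub_apply, Pi.smul_apply, Pi.single_eq_same, smul_eq_mul]
        fin_cases k <;> simp <;> ring
      · have hiff : w ∈ insert w₀ T ↔ w ∈ T := by simp [Finset.mem_insert, hw]
        by_cases hwT : w ∈ T
        · rw [flipSet_apply_of_mem (hiff.2 hwT), flipSet_apply_of_mem hwT]
          fin_cases k <;> simp [Pi.single_eq_of_ne hw]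
        · rw [flipSet_apply_of_not_mem (fun h => hwT (hiff.1 h)), flipSet_apply_of_not_mem hwT]
          simp [Pi.single_eq_of_ne hw]
    have hν1 : ∀ T : Finset {w : InfinitePlace L // IsComplex w}, w₀ ∉ T → (flipSet T c w₀ 0 - flipSet T c w₀ 2) / 2 = ((c w₀ 0 - c w₀ 2) / 2) := fun T hT => by
      rw [flipSet_apply_of_not_mem hT]
    have hν2 : ∀ T : Finset {w : InfinitePlace L // IsComplex w}, w₀ ∉ T → (flipSet (insert w₀ T) c w₀ 0 - flipSet (insert w₀ T) c w₀ 2) / 2 = -((c w₀ 0 - c w₀ 2) / 2) := fun T _ => by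
      rw [flipSet_apply_of_mem (Finset.mem_insert_self _ _)]
      simp only [Matrix.cons_val_zero, Matrix.cons_val_two, Matrix.tail_cons, Matrix.head_cons]
      ring
    -- the representation at the flip points
    have hrepT : ∀ T : Finset {w : InfinitePlace L // IsComplex w}, w₀ ∉ T →
        I (flipSet T c) = ℓ (∫ h : ↥(unitaryGroupOfForm (starRingEnd ℂ) (Matrix.map Φ₂[L] w₀.1.embedding)), g (flipSet T (c - ((c w₀ 0 - c w₀ 2) / 2) • hcNrm w₀ 0 2), (((h * ⟨Matrix.GeneralLinearGroup.mkOfDetNeZero !![(1 : ℂ), 1; 1, -1] det_cayleyTwo_ne_zero * circleDiagonal 2 ![1 * Circle.exp (((c w₀ 0 - c w₀ 2) / 2)), 1 * Circle.exp (-(((c w₀ 0 - c w₀ 2) / 2)))] * (Matrix.GeneralLinearGroup.mkOfDetNeZero !![(1 : ℂ), 1; 1, -1] det_cayleyTwo_ne_zero)⁻¹, cayley_conj_circleDiagonal_mem_of_eq_over hJ _⟩ * h⁻¹ : ↥(unitaryGroupOfForm (starRingEnd ℂ) (Matrix.map Φ₂[L] w₀.1.embedding))) : GL (Fin 2) ℂ)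 : Matrix (Fin 2) (Fin 2) ℂ)) ∂ν₀) := by
      intro T hT
      rw [hIrep (flipSet T c) ⟨hmemC₁ T c hcb, (flipSet_mem_inRegS_iff S T c).2 hcin⟩, hν1 T hT]
      simp_rw [key1 T hT, hgn]
    have hrepT2 : ∀ T : Finset {w : InfinitePlace L // IsComplex w}, w₀ ∉ T →
        I (flipSet (insert w₀ T) c) = ℓ (∫ h : ↥(unitaryGroupOfForm (starRingEnd ℂ) (Matrix.map Φ₂[L] w₀.1.embedding)), g (flipSet T (c - ((c w₀ 0 - c w₀ 2) / 2) • hcNrm w₀ 0 2), (((h * ⟨Matrix.GeneralLinearGroup.mkOfDetNeZero !![(1 : ℂ), 1; 1, -1] det_cayleyTwo_ne_zero * circleDiagonal 2 ![1 * Circle.exp (-((c w₀ 0 - c w₀ 2) / 2)), 1 * Circle.exp (-(-((c w₀ 0 - c w₀ 2) / 2)))] * (Matrix.GeneralLinearGroup.mkOfDetNeZero !![(1 : ℂ), 1; 1, -1] det_cayleyTwo_ne_zero)⁻¹, cayley_conj_circleDiagonal_mem_of_eq_over hJ _⟩ * h⁻¹ : ↥(unitaryGroupOfForm (starRingEnd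 ℂ) (Matrix.map Φ₂[L] w₀.1.embedding))) : GL (Fin 2) ℂ) : Matrix (Fin 2) (Fin 2) ℂ)) ∂ν₀) := by
      intro T hT
      rw [hIrep (flipSet (insert w₀ T) c) ⟨hmemC₁ (insert w₀ T) c hcb, (flipSet_mem_inRegS_iff S (insert w₀ T) c).2 hcin⟩, hν2 T hT]
      simp_rw [key2 T hT, hgn]
    -- `ℓ` inside and the flip sum as ONE test function
    have hint : ∀ (T : Finset {w : InfinitePlace L // IsComplex w}) (ψ : ℝ), Real.sin ψ ≠ 0 →
        Integrable (fun h : ↥(unitaryGroupOfForm (starRingEnd ℂ) (Matrix.map Φ₂[L] w₀.1.embedding)) => g (flipSet T (c - ((c w₀ 0 - c w₀ 2) / 2) • hcNrm w₀ 0 2), (((h * ⟨Matrix.GeneralLinearGroup.mkOfDetNeZero !![(1 : ℂ), 1; 1, -1] det_cayleyTwo_ne_zero * circleDiagonal 2 ![1 * Circle.exp (ψ), 1 * Circle.exp (-(ψ))] * (Matrix.GeneralLinearGroup.mkOfDetNeZero !![(1 : ℂ), 1; 1, -1] det_cayleyTwo_ne_zero)⁻¹, cayley_conj_circleDiagonal_mem_of_eq_over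 hJ _⟩ * h⁻¹ : ↥(unitaryGroupOfForm (starRingEnd ℂ) (Matrix.map Φ₂[L] w₀.1.embedding))) : GL (Fin 2) ℂ) : Matrix (Fin 2) (Fin 2) ℂ))) ν₀ := fun T ψ hψ =>
      integrable_comp_conj_cayleyTorus_of_support L w₀ hJ ν₀ (f := fun Y => g (flipSet T (c - ((c w₀ 0 - c w₀ 2) / 2) • hcNrm w₀ 0 2), Y)) (hg.continuous.comp (continuous_const.prodMk continuous_id))
        hKmat (fun X hX => hg0 _ _ hX) hψ
    have hΦG : ∀ ψ : ℝ, Real.sin ψ ≠ 0 →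
        Φ₁ (fun X => ∑ T ∈ (Finset.univ \ insert w₀ S).powerset, ℓ (g (flipSet T (c - ((c w₀ 0 - c w₀ 2) / 2) • hcNrm w₀ 0 2), X))) ψ =
          (2 * Real.sin ψ) • ∑ T ∈ (Finset.univ \ insert w₀ S).powerset, ℓ (∫ h : ↥(unitaryGroupOfForm (starRingEnd ℂ) (Matrix.map Φ₂[L] w₀.1.embedding)), g (flipSet T (c - ((c w₀ 0 - c w₀ 2) / 2) • hcNrm w₀ 0 2), (((h * ⟨Matrix.GeneralLinearGroup.mkOfDetNeZero !![(1 : ℂ), 1; 1, -1] det_cayleyTwo_ne_zero * circleDiagonal 2 ![1 * Circle.exp (ψ), 1 * Circle.exp (-(ψ))] * (Matrix.GeneralLinearGroup.mkOfDetNeZero !![(1 : ℂ), 1; 1, -1] det_cayleyTwo_ne_zero)⁻¹, cayley_conj_circleDiagonal_mem_of_eq_over hJ _⟩ * h⁻¹ : ↥(unitaryGroupOfForm (starRingEnd ℂ) (Matrix.map Φ₂[L] w₀.1.embedding))) : GL (Fin 2) ℂ) : Matrix (Fin 2) (Fin 2) ℂ)) ∂ν₀) := by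
      intro ψ hψ
      rw [hΦ₁, integral_finsetSum _ fun T _ => ℓ.integrable_comp (hint T ψ hψ)]
      congr 1
      exact Finset.sum_congr rfl fun T _ => ℓ.integral_comp_comm (hint T ψ hψ)
    -- the flip sum splits along `w₀`
    have hsdiff : Finset.univ \ S = insert w₀ (Finset.univ \ insert w₀ S) := by
      ext w
      simp only [Finset.mem_sdiff, Finset.mem_univ, true_and, Finset.mem_insert]
      by_cases hw : w = w₀
      · subst hw; simp [hw₀]
      · simp [hw]
    have hsplit : ∑ T ∈ (Finset.univ \ S).powerset, I (flipSet T c) =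
        ∑ T ∈ (Finset.univ \ insert w₀ S).powerset, I (flipSet T c) + ∑ T ∈ (Finset.univ \ insert w₀ S).powerset, I (flipSet (insert w₀ T) c) := by
      rw [hsdiff, Finset.sum_powerset_insert (by simp)]
    rw [hΨ c hcin, hsplit, Finset.sum_congr rfl fun T hT => hrepT T (hPS T hT), Finset.sum_congr rfl fun T hT => hrepT2 T (hPS T hT),
      hΦG _ hsin, hΦG _ (by rwa [Real.sin_neg, neg_ne_zero]), Complex.real_smul, Complex.real_smul, Real.sin_neg,
      expProd_congr_off L w₀ S (c - ((c w₀ 0 - c w₀ 2) / 2) • hcNrm w₀ 0 2) c (fun w hw => by simp [hnrm, nrm, Pi.single_eq_of_ne hw])]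
    have hE := archERho_mul_expProd_eq L w₀ S hw₀ c
    set A := ∑ T ∈ (Finset.univ \ insert w₀ S).powerset, ℓ (∫ h : ↥(unitaryGroupOfForm (starRingEnd ℂ) (Matrix.map Φ₂[L] w₀.1.embedding)), g (flipSet T (c - ((c w₀ 0 - c w₀ 2) / 2) • hcNrm w₀ 0 2), (((h * ⟨Matrix.GeneralLinearGroup.mkOfDetNeZero !![(1 : ℂ), 1; 1, -1] det_cayleyTwo_ne_zero * circleDiagonal 2 ![1 * Circle.exp (((c w₀ 0 - c w₀ 2) / 2)), 1 * Circle.exp (-(((c w₀ 0 - c w₀ 2) / 2)))] * (Matrix.GeneralLinearGroup.mkOfDetNeZero !![(1 : ℂ), 1; 1, -1] det_cayleyTwo_ne_zero)⁻¹, cayley_conj_circleDiagonal_mem_of_eq_over hJ _⟩ * h⁻¹ : ↥(unitaryGroupOfForm (starRingEnd ℂ) (Matrix.map Φ₂[L] w₀.1.embedding))) : GL (Fin 2) ℂ) : Matrix (Fin 2) (Fin 2) ℂ)) ∂ν₀) with hA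
    set B := ∑ T ∈ (Finset.univ \ insert w₀ S).powerset, ℓ (∫ h : ↥(unitaryGroupOfForm (starRingEnd ℂ) (Matrix.map Φ₂[L] w₀.1.embedding)), g (flipSet T (c - ((c w₀ 0 - c w₀ 2) / 2) • hcNrm w₀ 0 2), (((h * ⟨Matrix.GeneralLinearGroup.mkOfDetNeZero !![(1 : ℂ), 1; 1, -1] det_cayleyTwo_ne_zero * circleDiagonal 2 ![1 * Circle.exp (-((c w₀ 0 - c w₀ 2) / 2)), 1 * Circle.exp (-(-((c w₀ 0 - c w₀ 2) / 2)))] * (Matrix.GeneralLinearGroup.mkOfDetNeZero !![(1 : ℂ), 1; 1, -1] det_cayleyTwo_ne_zero)⁻¹, cayley_conj_circleDiagonal_mem_of_eq_over hJ _⟩ * h⁻¹ : ↥(unitaryGroupOfForm (starRingEnd ℂ) (Matrix.map Φ₂[L] w₀.1.embedding))) : GL (Fin 2) ℂ) : Matrix (Fin 2) (Fin 2) ℂ)) ∂ν₀) with hB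
    simp only [Complex.ofReal_mul, Complex.ofReal_neg, Complex.ofReal_ofNat]
    linear_combination ((K₀ : ℂ) * (A + B)) * hE
  · -- ═══ Step 4: `hdesc₂` — the split chart, THROUGH the real wall
    -- (4a) the identity off the real wall
    have haux : ∀ c : {w : InfinitePlace L // IsComplex w} → Fin 3 → ℝ, (Function.update c w₀ ![c w₀ 2, c w₀ 1, c w₀ 2]) ∈ Metric.ball p r → c w₀ 0 ≠ 0 →
        archERho (insert w₀ S) c * Ψ' c =
          ((K₀' * Ch : ℝ) : ℂ) * ((1 : ℂ) * (∏ w ∈ Finset.univ.erase w₀, ((if w ∈ S then (1 : ℂ) else (Circle.exp ((((Function.update c w₀ ![c w₀ 2, c w₀ 1, c w₀ 2])) w 0 - ((Function.update c w₀ ![c w₀ 2, c w₀ 1, c w₀ 2])) w 2) / 2) : ℂ)) * (if w ∈ S then ((Real.exp (((Function.update c w₀ ![c w₀ 2, c w₀ 1, c w₀ 2])) w 0) : ℝ) : ℂ) else 1 - (Circle.exp (((Function.update c w₀ ![c w₀ 2, c w₀ 1, c w₀ 2])) w 2 - ((Function.update c w₀ ![c w₀ 2, c w₀ 1, c w₀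 2])) w 0) : ℂ)))) - 0) *
            Φ₂ (fun X => ∑ T ∈ (Finset.univ \ insert w₀ S).powerset, ℓ (g (flipSet T (Function.update c w₀ ![c w₀ 2, c w₀ 1, c w₀ 2]), X))) (c w₀ 0) := by
      intro c hcb hx
      have hcb' : (Function.update c w₀ ![c w₀ 2, c w₀ 1, c w₀ 2]) ∈ Metric.closedBall p r := Metric.ball_subset_closedBall hcb
      have hcO : ∀ w, w ∉ S → w ≠ w₀ → Circle.exp (c w 0) ≠ Circle.exp (c w 2) := fun w hwS hww => by
        have h := hclosed _ hcb' w hwS hww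
        rwa [Function.update_of_ne hww] at h
      have hcin' : c ∈ InRegS (insert w₀ S) := fun w hw =>
        hcO w (fun h => hw (Finset.mem_insert_of_mem h)) (fun h => hw (h ▸ Finset.mem_insert_self w₀ S))
      have hPS : ∀ T ∈ (Finset.univ \ insert w₀ S).powerset, w₀ ∉ T := fun T hT h =>
        (Finset.mem_sdiff.1 (Finset.mem_powerset.1 hT h)).2 (Finset.mem_insert_self w₀ S)
      have hhatflip : ∀ T : Finset {w : InfinitePlace L // IsComplex w}, w₀ ∉ T →
          Function.update (flipSet T c) w₀ ![flipSet T c w₀ 2, flipSet T c w₀ 1, flipSet T c w₀ 2] = flipSet T (Function.update c w₀ ![c w₀ 2, c w₀ 1, c w₀ 2]) := by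
        intro T hT
        funext w
        by_cases hw : w = w₀
        · subst hw
          rw [Function.update_self, flipSet_apply_of_not_mem hT, flipSet_apply_of_not_mem hT, Function.update_self]
        · rw [Function.update_of_ne hw]
          by_cases hwT : w ∈ T
          · rw [flipSet_apply_of_mem hwT, flipSet_apply_of_mem hwT, Function.update_of_ne hw]
          · rw [flipSet_apply_of_not_mem hwT, flipSet_apply_of_not_mem hwT, Function.update_of_ne hw]
      have hrep'T : ∀ T : Finset {w : InfinitePlace L // IsComplex w}, w₀ ∉ T →
          I' (flipSet T c) = ℓ (∫ z : ↥(unitaryGroupOfForm (starRingEnd ℂ) (Matrix.map Φ₂[L] w₀.1.embedding)) × ↥(unitaryGroupOfForm (starRingEnd ℂ) (Matrix.map Φ₂[L] w₀.1.embedding)), g (flipSet T (Function.update c w₀ ![c w₀ 2, c w₀ 1, c w₀ 2]), ((Circle.exp (c w₀ 2) : ℂ))⁻¹ • (((z.1 * (γ' (c w₀) * z.2) * z.1⁻¹ : ↥(unitaryGroupOfForm (starRingEnd ℂ) (Matrix.map Φ₂[L] w₀.1.embedding))) : GL (Fin 2) ℂ) : Matrix (Fin 2) (Fin 2) ℂ))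 ∂Λ') := by
        intro T hT
        have hmem : Function.update (flipSet T c) w₀ ![flipSet T c w₀ 2, flipSet T c w₀ 1, flipSet T c w₀ 2] ∈ C₁ := by
          rw [hhatflip T hT]; exact hmemC₁ T _ hcb'
        rw [hI'rep (flipSet T c) hmem, hhatflip T hT, flipSet_apply_of_not_mem hT]
      -- integrability on the leaf
      have hKu : IsCompact {y : ↥(unitaryGroupOfForm (starRingEnd ℂ) (Matrix.map Φ₂[L] w₀.1.embedding)) | ((Circle.exp (c w₀ 2) : ℂ))⁻¹ • ((y : GL (Fin 2) ℂ) : Matrix (Fin 2) (Fin 2) ℂ) ∈ Kmat} :=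
        hemb.isCompact_preimage (((Homeomorph.smulOfNeZero ((Circle.exp (c w₀ 2) : ℂ))⁻¹ (inv_ne_zero (Circle.coe_ne_zero _))).isCompact_preimage).2 hKmat)
      have hprop1 : ∀ C' : Set ↥(unitaryGroupOfForm (starRingEnd ℂ) (Matrix.map Φ₂[L] w₀.1.embedding)), IsCompact C' → ∃ 𝒮' : Set (↥(unitaryGroupOfForm (starRingEnd ℂ) (Matrix.map Φ₂[L] w₀.1.embedding)) × ↥(unitaryGroupOfForm (starRingEnd ℂ) (Matrix.map Φ₂[L] w₀.1.embedding))), IsCompact 𝒮' ∧ ∀ z ∈ Z', z.1 * (γ' (c w₀) * z.2) * z.1⁻¹ ∈ C' → z ∈ 𝒮' :=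
        fun C' hC' => by
          obtain ⟨𝒮', h1, h2⟩ := hprop' {c} isCompact_singleton C' hC'
          exact ⟨𝒮', h1, fun z hz hmem => h2 z hz c (Set.mem_singleton c) hmem⟩
      have hint' : ∀ T : Finset {w : InfinitePlace L // IsComplex w}, Integrable (fun z : ↥(unitaryGroupOfForm (starRingEnd ℂ) (Matrix.map Φ₂[L] w₀.1.embedding)) × ↥(unitaryGroupOfForm (starRingEnd ℂ) (Matrix.map Φ₂[L] w₀.1.embedding)) => g (flipSet T (Function.update c w₀ ![c w₀ 2, c w₀ 1, c w₀ 2]), ((Circle.exp (c w₀ 2) : ℂ))⁻¹ • (((z.1 * (γ' (c w₀) * z.2) * z.1⁻¹ : ↥(unitaryGroupOfForm (starRingEnd ℂ) (Matrix.map Φ₂[L] w₀.1.embedding))) : GL (Fin 2) ℂ) : Matrix (Fin 2) (Fin 2) ℂ))) Λ' := fun T =>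
        integrable_comp_conj_leaf_of_support L w₀ Λ' Z' hZ'null (γ' (c w₀)) hprop1
          (φ := fun y : ↥(unitaryGroupOfForm (starRingEnd ℂ) (Matrix.map Φ₂[L] w₀.1.embedding)) => g (flipSet T (Function.update c w₀ ![c w₀ 2, c w₀ 1, c w₀ 2]), ((Circle.exp (c w₀ 2) : ℂ))⁻¹ • ((y : GL (Fin 2) ℂ) : Matrix (Fin 2) (Fin 2) ℂ)))
          (hg.continuous.comp (continuous_const.prodMk (hemb.continuous.const_smul ((Circle.exp (c w₀ 2) : ℂ))⁻¹))) hKu (fun y hy => hg0 _ _ hy)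
      -- the test function on the group and (JH-A′)
      have hGfc : Continuous fun y : ↥(unitaryGroupOfForm (starRingEnd ℂ) (Matrix.map Φ₂[L] w₀.1.embedding)) => ∑ T ∈ (Finset.univ \ insert w₀ S).powerset,
          ℓ (g (flipSet T (Function.update c w₀ ![c w₀ 2, c w₀ 1, c w₀ 2]), ((Circle.exp (c w₀ 2) : ℂ))⁻¹ • ((y : GL (Fin 2) ℂ) : Matrix (Fin 2) (Fin 2) ℂ))) :=
        continuous_finsetSum _ fun T _ => ℓ.continuous.comp (hg.continuous.comp (continuous_const.prodMk (hemb.continuous.const_smul ((Circle.exp (c w₀ 2) : ℂ))⁻¹)))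
      have hGfs : HasCompactSupport fun y : ↥(unitaryGroupOfForm (starRingEnd ℂ) (Matrix.map Φ₂[L] w₀.1.embedding)) => ∑ T ∈ (Finset.univ \ insert w₀ S).powerset,
          ℓ (g (flipSet T (Function.update c w₀ ![c w₀ 2, c w₀ 1, c w₀ 2]), ((Circle.exp (c w₀ 2) : ℂ))⁻¹ • ((y : GL (Fin 2) ℂ) : Matrix (Fin 2) (Fin 2) ℂ))) :=
        HasCompactSupport.intro hKu fun y hy => Finset.sum_eq_zero fun T _ => by rw [hg0 _ _ hy, map_zero]
      have hh := hhalf _ hGfc hGfs c hx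
      beta_reduce at hh
      -- the flip sum of `I′` is the leaf integral of the summed test function
      have hsum : ∑ T ∈ (Finset.univ \ insert w₀ S).powerset, I' (flipSet T c) =
          ∫ z : ↥(unitaryGroupOfForm (starRingEnd ℂ) (Matrix.map Φ₂[L] w₀.1.embedding)) × ↥(unitaryGroupOfForm (starRingEnd ℂ) (Matrix.map Φ₂[L] w₀.1.embedding)), ∑ T ∈ (Finset.univ \ insert w₀ S).powerset,
            ℓ (g (flipSet T (Function.update c w₀ ![c w₀ 2, c w₀ 1, c w₀ 2]), ((Circle.exp (c w₀ 2) : ℂ))⁻¹ • (((z.1 * (γ' (c w₀) * z.2) * z.1⁻¹ : ↥(unitaryGroupOfForm (starRingEnd ℂ) (Matrix.map Φ₂[L] w₀.1.embedding))) : GL (Fin 2) ℂ) : Matrix (Fin 2) (Fin 2) ℂ))) ∂Λ' := by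
        rw [integral_finsetSum _ fun T _ => ℓ.integrable_comp (hint' T)]
        exact Finset.sum_congr rfl fun T hT => by rw [hrep'T T (hPS T hT), ℓ.integral_comp_comm (hint' T)]
      rw [hΨ' c hcin', hsum, hh]
      simp_rw [inv_coe_circleExp_smul_coe_conj_hypBlockGL_zero L w₀ hJ]
      have hΦ₂' := hΦ₂ (fun X => ∑ T ∈ (Finset.univ \ insert w₀ S).powerset, ℓ (g (flipSet T (Function.update c w₀ ![c w₀ 2, c w₀ 1, c w₀ 2]), X))) (c w₀ 0)
      beta_reduce at hΦ₂'
      rw [← hΦ₂', Complex.real_smul, expProd_congr_off L w₀ S (Function.update c w₀ ![c w₀ 2, c w₀ 1, c w₀ 2]) c (fun w hw => Function.update_of_ne hw _ _)]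
      have hE' := archERho_insert_mul_expProd_eq L w₀ S c
      have hexp : ((Real.exp (c w₀ 0) : ℝ) : ℂ) * ((Real.exp (-(c w₀ 0)) : ℝ) : ℂ) = 1 := by
        rw [← Complex.ofReal_mul, ← Real.exp_add, add_neg_cancel, Real.exp_zero, Complex.ofReal_one]
      set Q := Φ₂ (fun X => ∑ T ∈ (Finset.univ \ insert w₀ S).powerset, ℓ (g (flipSet T (Function.update c w₀ ![c w₀ 2, c w₀ 1, c w₀ 2]), X))) (c w₀ 0) with hQ
      simp only [Complex.ofReal_mul]
      linear_combination ((K₀' : ℂ) * ((Ch : ℂ) * ((Real.exp (-(c w₀ 0)) : ℝ) : ℂ) * Q)) * hE' +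
        ((K₀' : ℂ) * (Ch : ℂ) * (∏ w ∈ Finset.univ.erase w₀, ((if w ∈ S then (1 : ℂ) else (Circle.exp (((c) w 0 - (c) w 2) / 2) : ℂ)) * (if w ∈ S then ((Real.exp ((c) w 0) : ℝ) : ℂ) else 1 - (Circle.exp ((c) w 2 - (c) w 0) : ℂ)))) * Q) * hexp
    -- (4b) through the real wall by continuity along `t ↦ c + t • e_{w₀,0}`
    intro c hcU
    simp only [Set.mem_setOf_eq] at hcU
    rw [hhat c]
    by_cases hx : c w₀ 0 ≠ 0
    · exact haux c hcU hx
    push Not at hx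
    -- the path and its properties
    have hpath_hat : ∀ t : ℝ, Function.update (c + t • (Pi.single w₀ (Pi.single 0 1 : Fin 3 → ℝ) : {w : InfinitePlace L // IsComplex w} → Fin 3 → ℝ)) w₀
        ![(c + t • (Pi.single w₀ (Pi.single 0 1 : Fin 3 → ℝ) : {w : InfinitePlace L // IsComplex w} → Fin 3 → ℝ)) w₀ 2, (c + t • (Pi.single w₀ (Pi.single 0 1 : Fin 3 → ℝ) : {w : InfinitePlace L // IsComplex w} → Fin 3 → ℝ)) w₀ 1,
          (c + t • (Pi.single w₀ (Pi.single 0 1 : Fin 3 → ℝ) : {w : InfinitePlace L // IsComplex w} → Fin 3 → ℝ)) w₀ 2] = (Function.update c w₀ ![c w₀ 2, c w₀ 1, c w₀ 2]) := by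
      intro t
      funext w
      by_cases hw : w = w₀
      · subst hw
        simp only [Function.update_self, Pi.add_apply, Pi.smul_apply, Pi.single_eq_same, smul_eq_mul]
        funext s; fin_cases s <;> simp
      · rw [Function.update_of_ne hw, Function.update_of_ne hw]
        simp [Pi.single_eq_of_ne hw]
    have hpath0 : ∀ t : ℝ, (c + t • (Pi.single w₀ (Pi.single 0 1 : Fin 3 → ℝ) : {w : InfinitePlace L // IsComplex w} → Fin 3 → ℝ)) w₀ 0 = t := fun t => by
      simp [hx]
    have hpathreg : ∀ t : ℝ, c + t • (Pi.single w₀ (Pi.single 0 1 : Fin 3 → ℝ) : {w : InfinitePlace L // IsComplex w} → Fin 3 → ℝ) ∈ InRegS (insert w₀ S) := by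
      intro t w hw
      have hww : w ≠ w₀ := fun h => hw (h ▸ Finset.mem_insert_self w₀ S)
      have hwS : w ∉ S := fun h => hw (Finset.mem_insert_of_mem h)
      have h := hclosed _ (Metric.ball_subset_closedBall hcU) w hwS hww
      rw [Function.update_of_ne hww] at h
      simpa [Pi.single_eq_of_ne hww] using h
    -- the two sides along the path
    have hL : Tendsto (fun t : ℝ => archERho (insert w₀ S) (c + t • (Pi.single w₀ (Pi.single 0 1 : Fin 3 → ℝ) : {w : InfinitePlace L // IsComplex w} → Fin 3 → ℝ)) *
        Ψ' (c + t • (Pi.single w₀ (Pi.single 0 1 : Fin 3 → ℝ) : {w : InfinitePlace L // IsComplex w} → Fin 3 → ℝ))) (𝓝[≠] 0)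
        (𝓝 (archERho (insert w₀ S) c * Ψ' c)) := by
      have hγ : Continuous fun t : ℝ => c + t • (Pi.single w₀ (Pi.single 0 1 : Fin 3 → ℝ) : {w : InfinitePlace L // IsComplex w} → Fin 3 → ℝ) := continuous_const.add (continuous_id.smul continuous_const)
      have h1 : Continuous fun t : ℝ => archERho (insert w₀ S) (c + t • (Pi.single w₀ (Pi.single 0 1 : Fin 3 → ℝ) : {w : InfinitePlace L // IsComplex w} → Fin 3 → ℝ)) :=
        (contDiff_archERho (insert w₀ S)).continuous.comp hγ
      have h2 : Continuous fun t : ℝ => Ψ' (c + t • (Pi.single w₀ (Pi.single 0 1 : Fin 3 → ℝ) : {w : InfinitePlace L // IsComplex w} → Fin 3 → ℝ)) :=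
        hΨ'c.comp_continuous hγ hpathreg
      have h12 : Continuous fun t : ℝ => archERho (insert w₀ S) (c + t • (Pi.single w₀ (Pi.single 0 1 : Fin 3 → ℝ) : {w : InfinitePlace L // IsComplex w} → Fin 3 → ℝ)) *
          Ψ' (c + t • (Pi.single w₀ (Pi.single 0 1 : Fin 3 → ℝ) : {w : InfinitePlace L // IsComplex w} → Fin 3 → ℝ)) := h1.mul h2
      have h3 := (h12.tendsto 0).mono_left (nhdsWithin_le_nhds (s := ({(0 : ℝ)}ᶜ : Set ℝ)))
      simpa only [zero_smul, add_zero] using h3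
    have hΦ₂c : Continuous fun t : ℝ => Φ₂ (fun X => ∑ T ∈ (Finset.univ \ insert w₀ S).powerset, ℓ (g (flipSet T (Function.update c w₀ ![c w₀ 2, c w₀ 1, c w₀ 2]), X))) t := by
      haveI : CompactSpace ↥K := isCompact_iff_compactSpace.1 hK
      have h := contDiff_splitIntegral_param hJ κK μN hK 0 Φ₂ hΦ₂ (Q := {w : InfinitePlace L // IsComplex w} → Fin 3 → ℝ)
        (fun q X => ∑ T ∈ (Finset.univ \ insert w₀ S).powerset, ℓ (g (flipSet T q, X)))
        (ContDiff.sum fun T _ => ℓ.contDiff.comp (hg.comp (((hflipcd T).comp contDiff_fst).prodMk contDiff_snd)))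
        ⟨Kmat, hKmat, fun q X hX => Finset.sum_eq_zero fun T _ => by rw [hg0 _ _ hX, map_zero]⟩
      exact h.continuous.comp (continuous_const.prodMk continuous_id)
    have hR : Tendsto (fun t : ℝ => ((K₀' * Ch : ℝ) : ℂ) * ((1 : ℂ) * (∏ w ∈ Finset.univ.erase w₀, ((if w ∈ S then (1 : ℂ) else (Circle.exp ((((Function.update c w₀ ![c w₀ 2, c w₀ 1, c w₀ 2])) w 0 - ((Function.update c w₀ ![c w₀ 2, c w₀ 1, c w₀ 2])) w 2) / 2) : ℂ)) * (if w ∈ S then ((Real.exp (((Function.update c w₀ ![c w₀ 2, c w₀ 1, c w₀ 2])) w 0) : ℝ) : ℂ) else 1 - (Circle.exp (((Function.update c w₀ ![c w₀ 2, c w₀ 1, c w₀ 2])) w 2 - ((Function.update c w₀ ![c w₀ 2, c w₀ 1, c w₀ 2])) w 0) : ℂ)))) - 0) *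
        Φ₂ (fun X => ∑ T ∈ (Finset.univ \ insert w₀ S).powerset, ℓ (g (flipSet T (Function.update c w₀ ![c w₀ 2, c w₀ 1, c w₀ 2]), X))) t) (𝓝[≠] 0)
        (𝓝 (((K₀' * Ch : ℝ) : ℂ) * ((1 : ℂ) * (∏ w ∈ Finset.univ.erase w₀, ((if w ∈ S then (1 : ℂ) else (Circle.exp ((((Function.update c w₀ ![c w₀ 2, c w₀ 1, c w₀ 2])) w 0 - ((Function.update c w₀ ![c w₀ 2, c w₀ 1, c w₀ 2])) w 2) / 2) : ℂ)) * (if w ∈ S then ((Real.exp (((Function.update c w₀ ![c w₀ 2, c w₀ 1, c w₀ 2])) w 0) : ℝ) : ℂ) else 1 - (Circle.exp (((Function.update c w₀ ![c w₀ 2, c w₀ 1, c w₀ 2])) w 2 - ((Function.update c w₀ ![c w₀ 2, c w₀ 1, c w₀ 2])) w 0) : ℂ)))) - 0) *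
          Φ₂ (fun X => ∑ T ∈ (Finset.univ \ insert w₀ S).powerset, ℓ (g (flipSet T (Function.update c w₀ ![c w₀ 2, c w₀ 1, c w₀ 2]), X))) (c w₀ 0))) := by
      rw [hx]
      exact ((continuous_const.mul hΦ₂c).tendsto 0).mono_left (nhdsWithin_le_nhds (s := ({(0 : ℝ)}ᶜ : Set ℝ)))
    have heq : ∀ᶠ t : ℝ in 𝓝[≠] 0, archERho (insert w₀ S) (c + t • (Pi.single w₀ (Pi.single 0 1 : Fin 3 → ℝ) : {w : InfinitePlace L // IsComplex w} → Fin 3 → ℝ)) *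
        Ψ' (c + t • (Pi.single w₀ (Pi.single 0 1 : Fin 3 → ℝ) : {w : InfinitePlace L // IsComplex w} → Fin 3 → ℝ)) =
        ((K₀' * Ch : ℝ) : ℂ) * ((1 : ℂ) * (∏ w ∈ Finset.univ.erase w₀, ((if w ∈ S then (1 : ℂ) else (Circle.exp ((((Function.update c w₀ ![c w₀ 2, c w₀ 1, c w₀ 2])) w 0 - ((Function.update c w₀ ![c w₀ 2, c w₀ 1, c w₀ 2])) w 2) / 2) : ℂ)) * (if w ∈ S then ((Real.exp (((Function.update c w₀ ![c w₀ 2, c w₀ 1, c w₀ 2])) w 0) : ℝ) : ℂ) else 1 - (Circle.exp (((Function.update c w₀ ![c w₀ 2, c w₀ 1, c w₀ 2])) w 2 - ((Function.update c w₀ ![c w₀ 2, c w₀ 1, c w₀ 2])) w 0) : ℂ)))) - 0) *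
          Φ₂ (fun X => ∑ T ∈ (Finset.univ \ insert w₀ S).powerset, ℓ (g (flipSet T (Function.update c w₀ ![c w₀ 2, c w₀ 1, c w₀ 2]), X))) t := by
      filter_upwards [self_mem_nhdsWithin] with t ht
      have h := haux (c + t • (Pi.single w₀ (Pi.single 0 1 : Fin 3 → ℝ) : {w : InfinitePlace L // IsComplex w} → Fin 3 → ℝ)) (by rw [hpath_hat t]; exact hcU) (by rw [hpath0 t]; exact ht)
      rw [hpath_hat t, hpath0 t] at h
      exact h
    exact tendsto_nhds_unique_of_eventuallyEq hL hR heq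

end Package

end Literature.NumberTheory.Rogawski1990

end
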